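import Summits.Ventures.PercRepro.Night2RigidPairLoss

/-!
# PercRepro — the regime `|E ∖ G| ≤ q`: coloop counts and the thin covering preimages (night-2, gen 19)

Uniform structure facts behind the cells of the `(7, 5)` row with `|E ∖ G| = q − 1` (`proofs/NIGHT-2-g19.md` §1),
stated for every flat with `|E ∖ G| ≤ q`.  With `K = coloops (M|G)` and `ρ := q + 1 − kColoops`:

* a shadow set `S` with closure `G` has `ρ(S ∖ K) = ρ` (`eRk_sdiff_coloops_eq_of_mem_shadowAt`) and a thin member
  `B` has `ρ(B ∖ K) = ρ − 1` (`eRk_sdiff_coloops_thin`), both from `eRk_eq_kColoops_add_sdiff`;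
* every thin covering preimage of `S` is `S ∖ w` for a coloop `w` of `M|(S ∖ K)`
  (`thin_coverPreimages_subset_image_coloops`);
* **`card_coloops_add_two_le`**: in a simple loopless matroid a set `P` of rank `u` with `|P| ≥ u + 1` has at most
  `u − 2` coloops (`ρ(P) = #coloops + ρ(P ∖ coloops)`, and a set of rank `≤ 1` has at most one element);
* hence **`card_thin_coverPreimages_add_two_le`**: a shadow set with `|S ∖ K| ≥ ρ + 1` has at most `ρ − 2` thin
  covering preimages — the rigid cell's `card_thin_coverPreimages_le_one` (`ρ = 3`) at every `ρ`.
-/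

namespace PercRepro.Shadow

open Finset PerFlat ThmH

variable {α : Type*} [DecidableEq α] {M : Matroid α} [M.Finite]

/-! ## Rank and size in a simple loopless matroid -/

/-- A subset of the ground set of rank `≤ 1` in a simple matroid has at most one element. -/
theorem card_le_one_of_eRk_le_one_dqm1 (hs : ∀ e ∈ gr M, ∀ f ∈ gr M, e ≠ f → rkN M {e, f} = 2) {X : Finset α}
    (hX : X ⊆ gr M) (h : M.eRk (X : Set α) ≤ 1) : X.card ≤ 1 := by
  by_contra hc
  obtain ⟨a, ha, b, hb, hab⟩ := Finset.one_lt_card.1 (by omega : 1 < X.card)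
  have h2 : M.eRk (({a, b} : Finset α) : Set α) = 2 := eRk_pair_two_simple_rigid hs (hX ha) (hX hb) hab
  have hle : M.eRk (({a, b} : Finset α) : Set α) ≤ M.eRk (X : Set α) := by
    apply M.eRk_mono
    intro x hx
    rw [Finset.mem_coe, Finset.mem_insert, Finset.mem_singleton] at hx
    rcases hx with rfl | rfl
    · exact_mod_cast ha
    · exact_mod_cast hb
  rw [h2] at hle
  have : (2 : ℕ∞) ≤ 1 := hle.trans h
  exact absurd this (by decide)

omit [DecidableEq α] in
/-- In a loopless matroid a nonempty subset of the ground set has rank `≥ 1`. -/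
theorem one_le_eRk_of_nonempty (hl : ∀ e ∈ gr M, M.Indep {e}) {X : Finset α} (hX : X ⊆ gr M)
    (hne : X.Nonempty) : 1 ≤ M.eRk (X : Set α) := by
  obtain ⟨e, he⟩ := hne
  have h1 : M.eRk ({e} : Set α) = 1 := by
    rw [(hl e (hX he)).eRk_eq_encard, Set.encard_singleton]
  rw [← h1]
  apply M.eRk_mono
  intro x hx
  rw [Set.mem_singleton_iff] at hx
  rw [hx]; exact_mod_cast he

/-- The rank of a set splits over its coloops: `ρ(P) = #coloops (M|P) + ρ(P ∖ coloops (M|P))`. -/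
theorem eRk_eq_card_coloops_add_sdiff {P : Finset α} (hP : P ⊆ gr M) :
    M.eRk (P : Set α) = ((coloops M P).card : ℕ∞) + M.eRk ((P \ coloops M P : Finset α) : Set α) := by
  have hY : ∀ y ∈ coloops M P, y ∈ P ∧ y ∉ clF M (P.erase y) := fun y hy => mem_coloops.1 hy
  have hK : coloops M P ⊆ P := fun y hy => (mem_coloops.1 hy).1
  have hunion : coloops M P ∪ (P \ coloops M P) = P := Finset.union_sdiff_of_subset hK
  conv_lhs => rw [← hunion]
  exact eRk_union_coloops hP (coloops M P) hY Finset.sdiff_subset Finset.disjoint_sdiff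

/-- **Coloop count.**  In a simple loopless matroid a set `P` of rank `u` with `|P| ≥ u + 1` has at most `u − 2`
coloops. -/
theorem card_coloops_add_two_le (hs : ∀ e ∈ gr M, ∀ f ∈ gr M, e ≠ f → rkN M {e, f} = 2)
    (hl : ∀ e ∈ gr M, M.Indep {e}) {P : Finset α} (hP : P ⊆ gr M) {u : ℕ}
    (hu : M.eRk (P : Set α) = (u : ℕ∞)) (hcard : u + 1 ≤ P.card) : (coloops M P).card + 2 ≤ u := by
  have hK : coloops M P ⊆ P := fun y hy => (mem_coloops.1 hy).1
  have hsplit := eRk_eq_card_coloops_add_sdiff hP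
  rw [hu] at hsplit
  obtain ⟨m, hm⟩ := ENat.ne_top_iff_exists.1 (eRk_ne_top (P \ coloops M P))
  rw [← hm] at hsplit
  have hum : u = (coloops M P).card + m := by exact_mod_cast hsplit
  have hPcard : P.card = (coloops M P).card + (P \ coloops M P).card := by
    rw [← Finset.card_union_of_disjoint Finset.disjoint_sdiff, Finset.union_sdiff_of_subset hK]
  by_contra hcon
  have hm1 : m ≤ 1 := by omega
  -- the non-coloop part has at most m elements
  have hX : (P \ coloops M P).card ≤ m := by
    rcases Nat.le_one_iff_eq_zero_or_eq_one.1 hm1 with h0 | h1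
    · rw [h0] at hm ⊢
      by_contra hne
      have hne' : (P \ coloops M P).Nonempty := by
        rw [← Finset.card_pos]; omega
      have := one_le_eRk_of_nonempty hl (Finset.sdiff_subset.trans hP) hne'
      rw [← hm] at this
      exact absurd this (by decide)
    · rw [h1] at hm ⊢
      exact card_le_one_of_eRk_le_one_dqm1 hs (Finset.sdiff_subset.trans hP) (by rw [← hm]; norm_num)
  omega

/-! ## The regime `|E ∖ G| ≤ q`: ranks off the coloops -/

open scoped Classical in
/-- A shadow set `S` with closure `G` has `ρ(S ∖ K) = ρ` where `kColoops + ρ = q + 1`. -/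
theorem eRk_sdiff_coloops_eq_of_mem_shadowAt {q ρ : ℕ} {G : Finset α} (hG : G ∈ flatsQ M (q + 1))
    (hk : kColoops M G + ρ = q + 1) {S : Finset α} (hS : S ∈ shadowAt M (q + 2) q (Uq M (q + 2) q) G) :
    M.eRk ((S \ coloops M G : Finset α) : Set α) = (ρ : ℕ∞) := by
  have hGg : G ⊆ gr M := (mem_flatsQ.1 hG).1
  have hSG : S ⊆ G := subset_G_of_mem_shadowAt hS
  have hKS : coloops M G ⊆ S := coloops_subset_of_mem_shadowAt hS
  have hSr : M.eRk (S : Set α) = ((q + 1 : ℕ) : ℕ∞) :=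
    eRk_eq_of_mem_Yq_diag (mem_shadow.1 (mem_shadowAt.1 hS).1).1
  have h := eRk_eq_kColoops_add_sdiff hGg hSG hKS
  rw [hSr] at h
  obtain ⟨n, hn⟩ := ENat.ne_top_iff_exists.1 (eRk_ne_top (S \ coloops M G))
  rw [← hn] at h ⊢
  have : q + 1 = kColoops M G + n := by exact_mod_cast h
  have : n = ρ := by omega
  rw [this]

open scoped Classical in
/-- A thin member `B` has `ρ(B ∖ K) = ρ − 1` where `kColoops + ρ = q + 1` (`|E ∖ G| ≤ q`). -/
theorem eRk_sdiff_coloops_thin {q ρ : ℕ} {G : Finset α} (hG : G ∈ flatsQ M (q + 1))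
    (hd : (gr M \ G).card ≤ q) (hk : kColoops M G + ρ = q + 1) {B : Finset α} (hB : B ∈ thinMembers M q G) :
    M.eRk ((B \ coloops M G : Finset α) : Set α) = ((ρ - 1 : ℕ) : ℕ∞) := by
  have hB' : B ∈ membersIn M (Uq M (q + 2) q) G := (mem_thinMembers.1 hB).1
  have hBU : B ∈ Uq M (q + 2) q := (mem_membersIn.1 hB').1
  have hBG : B ⊆ G := (subset_clF hBU).trans (mem_membersIn.1 hB').2
  have hK := coloops_subset_of_mem_thinMembers hG hd hB
  have hr : M.eRk (B : Set α) = (q : ℕ∞) := (mem_Uq.1 hBU).2.1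
  have h := eRk_eq_kColoops_add_sdiff (mem_flatsQ.1 hG).1 hBG hK
  rw [hr] at h
  obtain ⟨n, hn⟩ := ENat.ne_top_iff_exists.1 (eRk_ne_top (B \ coloops M G))
  rw [← hn] at h ⊢
  have : q = kColoops M G + n := by exact_mod_cast h
  have : n = ρ - 1 := by omega
  rw [this]

open scoped Classical in
/-- A thin member has at least `ρ − 1` elements off the coloops. -/
theorem card_sdiff_coloops_thin_ge {q ρ : ℕ} {G : Finset α} (hG : G ∈ flatsQ M (q + 1))
    (hd : (gr M \ G).card ≤ q) (hk : kColoops M G + ρ = q + 1) {B : Finset α} (hB : B ∈ thinMembers M q G) :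
    ρ - 1 ≤ (B \ coloops M G).card := by
  have hr := eRk_sdiff_coloops_thin hG hd hk hB
  have hle : M.eRk ((B \ coloops M G : Finset α) : Set α) ≤ ((B \ coloops M G).card : ℕ∞) := by
    calc M.eRk ((B \ coloops M G : Finset α) : Set α) ≤ ((B \ coloops M G : Finset α) : Set α).encard :=
          M.eRk_le_encard _
      _ = ((B \ coloops M G).card : ℕ∞) := by rw [Set.encard_coe_eq_coe_finsetCard]
  rw [hr] at hle
  exact_mod_cast hle

/-! ## The thin covering preimages of a shadow set -/

open scoped Classical in
/-- Every thin covering preimage of a set `S` is `S ∖ w` for a coloop `w` of `M|(S ∖ K)` (`|E ∖ G| ≤ q`). -/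
theorem thin_coverPreimages_subset_image_coloops {q : ℕ} {G : Finset α} (hG : G ∈ flatsQ M (q + 1))
    (hd : (gr M \ G).card ≤ q) (S : Finset α) :
    (coverPreimages M (Uq M (q + 2) q) G S).filter (fun B => B ∉ lay0 M q G) ⊆
      (coloops M (S \ coloops M G)).image (fun w => S.erase w) := by
  intro B hB
  rw [Finset.mem_filter, mem_coverPreimages] at hB
  obtain ⟨⟨hBm, hcov⟩, hB0⟩ := hB
  obtain ⟨w, hw, hwS⟩ := mem_coverSets.1 hcov
  have hBU : B ∈ Uq M (q + 2) q := (mem_membersIn.1 hBm).1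
  have hwB : w ∉ B := notMem_of_notMem_clF hBU (Finset.mem_sdiff.1 hw).2
  have hBt : B ∈ thinMembers M q G := mem_thinMembers.2 ⟨hBm, hB0⟩
  have hK := coloops_subset_of_mem_thinMembers hG hd hBt
  have hwK : w ∉ coloops M G := fun h => hwB (hK h)
  have hBe : S.erase w = B := by rw [← hwS, Finset.erase_insert hwB]
  rw [Finset.mem_image]
  refine ⟨w, ?_, hBe⟩
  rw [mem_coloops]
  refine ⟨Finset.mem_sdiff.2 ⟨by rw [← hwS]; exact Finset.mem_insert_self _ _, hwK⟩, ?_⟩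
  -- (S ∖ K) ∖ w ⊆ B, whose closure misses w
  have hsub : (S \ coloops M G).erase w ⊆ B := by
    intro x hx
    rw [Finset.mem_erase, Finset.mem_sdiff] at hx
    rw [← hBe, Finset.mem_erase]
    exact ⟨hx.1, hx.2.1⟩
  intro hcl
  exact (Finset.mem_sdiff.1 hw).2 (clF_mono hsub hcl)

open scoped Classical in
/-- **A shadow set with `|S ∖ K| ≥ ρ + 1` has at most `ρ − 2` thin covering preimages** (`M` simple loopless,
`|E ∖ G| ≤ q`, `kColoops + ρ = q + 1`). -/
theorem card_thin_coverPreimages_add_two_le {q ρ : ℕ} {G : Finset α} (hG : G ∈ flatsQ M (q + 1))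
    (hd : (gr M \ G).card ≤ q) (hk : kColoops M G + ρ = q + 1)
    (hs : ∀ e ∈ gr M, ∀ f ∈ gr M, e ≠ f → rkN M {e, f} = 2) (hl : ∀ e ∈ gr M, M.Indep {e}) {S : Finset α}
    (hS : S ∈ shadowAt M (q + 2) q (Uq M (q + 2) q) G) (hcard : ρ + 1 ≤ (S \ coloops M G).card) :
    ((coverPreimages M (Uq M (q + 2) q) G S).filter (fun B => B ∉ lay0 M q G)).card + 2 ≤ ρ := by
  have hGg : G ⊆ gr M := (mem_flatsQ.1 hG).1
  have hSG : S ⊆ G := subset_G_of_mem_shadowAt hS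
  have hPg : S \ coloops M G ⊆ gr M := Finset.sdiff_subset.trans (hSG.trans hGg)
  have hPr := eRk_sdiff_coloops_eq_of_mem_shadowAt hG hk hS
  have hC := card_coloops_add_two_le hs hl hPg hPr hcard
  have h1 := Finset.card_le_card (thin_coverPreimages_subset_image_coloops hG hd S)
  have h2 := Finset.card_image_le (s := coloops M (S \ coloops M G)) (f := fun w => S.erase w)
  omega

end PercRepro.Shadow
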